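import Mathlib.RingTheory.AdjoinRoot
import Mathlib.RingTheory.Polynomial.Cyclotomic.Basic
import Mathlib.Algebra.Ring.TransferInstance
import Summits.MatrixMultiplication.OmegaCensus.RingMetaCyclic

/-!
# ω-census, family (b3): the groups `(ℤ[ζ₇]/p) ⋊ C₇` as a kernel-usable type with computable COORDINATES (Schmidt atoms `A(p,7)`, `k = 6`)

HONEST FRAMING (pub-omega census; verbatim): lottery ticket; floor = certified bounds/negative ranges.
Census BOOKKEEPING (conjecture C9 of the cell; pub-omega stpp-1 gen 22).  For a prime `p` of order `6` mod `7` (`p ≡ 3, 5 (mod 7)`)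
the Schmidt atom `A(p,7) = 𝔽_{p⁶} ⋊ μ₇` is `(ℤ[ζ₇]/p) ⋊ ζ`.  MODEL for every `p`: the abstract ring `A7 p = 𝔽_p[X]/(Φ₇)`
(`AdjoinRoot`), its power basis `1, r, …, r⁵` (`AdjoinRoot.powerBasis'`, reindexed to `Fin 6`), and the COORDINATE TYPE
`Z7 p = (Fin 6 → 𝔽_p)` (a structure, `DecidableEq`, `Fintype`, `|Z7 p| = p⁶`) carrying the ring structure TRANSPORTED along the
coordinate isomorphism (`Equiv.commRing`; noncomputable operations, computable coordinates).  Proved: coordinates are additive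
(`add_v`, `sub_v`), the generator `zeta` satisfies `ζ⁷ = 1` (`zeta_pow_seven`, from `Φ₇ · (X − 1) = X⁷ − 1`), and
**`zeta_mul_v`**: multiplication by `ζ` acts on coordinates by the companion shift `(c₀,…,c₅) ↦ (−c₅, c₀ − c₅, …, c₄ − c₅)`
(from `1 + r + ⋯ + r⁶ = 0`); hence `ζ^s · toC ι w = toC ι (lzpow7 s w)` (`act_zeta_toC`) for integer coordinate vectors scaled by
`ι` (take `ι = 2⁻¹`).  The group `Z7Cyc p = RCyc (Z7 p) 7 zeta` has order `7p⁶`.  The 6-D half-block construction (phases mod 2,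
exact constant errors; seat numerics code/inertq.py: one 144-block pattern serves every prime `p ≥ 11`) is the successor files'.
Nothing here is progress on `ω`.
-/

namespace Summit.MatrixMultiplication.OmegaCensus

open Polynomial

noncomputable section

/-- `Φ₇` over `𝔽_p`. [folklore] -/
def cycPoly7 (p : ℕ) : (ZMod p)[X] := cyclotomic 7 (ZMod p)

/-- `Φ₇` is monic. [folklore] -/
theorem cycPoly7_monic (p : ℕ) : (cycPoly7 p).Monic := cyclotomic.monic 7 _

/-- The abstract ring `𝔽_p[X]/(Φ₇) ≅ ℤ[ζ₇]/p`. [folklore] -/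
abbrev A7 (p : ℕ) : Type := AdjoinRoot (cycPoly7 p)

namespace A7

variable {p : ℕ}

/-- The class of `X`: `r = ζ₇`. [folklore] -/
def r : A7 p := AdjoinRoot.root (cycPoly7 p)

/-- `1 + r + r² + ⋯ + r⁶ = 0`. [folklore] -/
theorem sum_pow_r : (1 : A7 p) + r + r ^ 2 + r ^ 3 + r ^ 4 + r ^ 5 + r ^ 6 = 0 := by
  haveI : Fact (Nat.Prime 7) := ⟨by decide⟩
  have h : AdjoinRoot.mk (cycPoly7 p) (∑ i ∈ Finset.range 7, X ^ i) = 0 := by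
    rw [← cyclotomic_prime (ZMod p) 7]
    exact AdjoinRoot.mk_self
  simp only [Finset.sum_range_succ, Finset.sum_range_zero, zero_add, map_add, map_pow, AdjoinRoot.mk_X, pow_zero,
    pow_one, map_one] at h
  unfold r
  linear_combination h

/-- `r⁷ = 1`. [folklore] -/
theorem r_pow_seven : (r : A7 p) ^ 7 = 1 := by
  have h := sum_pow_r (p := p)
  linear_combination (r - 1) * h

variable [Fact (1 < p)]

/-- The power basis `1, r, …, r⁵` of `A7 p` (dimension `natDegree Φ₇ = 6`). [folklore] -/
def pb : PowerBasis (ZMod p) (A7 p) := AdjoinRoot.powerBasis' (cycPoly7_monic p)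

/-- Its dimension is `6`. [folklore] -/
theorem pb_dim : (pb (p := p)).dim = 6 := by
  rw [pb, AdjoinRoot.powerBasis'_dim, cycPoly7, natDegree_cyclotomic, Nat.totient_prime (by decide)]

/-- The basis `k ↦ r^k`, `k : Fin 6`. [folklore] -/
def bQ : Module.Basis (Fin 6) (ZMod p) (A7 p) := (pb (p := p)).basis.reindex (finCongr pb_dim)

/-- `bQ k = r ^ k`. [folklore] -/
theorem bQ_apply (k : Fin 6) : bQ k = (r : A7 p) ^ (k : ℕ) := by
  rw [bQ, Module.Basis.reindex_apply, PowerBasis.coe_basis]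
  rfl

end A7

end

/-- The coordinate type of `ℤ[ζ₇]/p`: vectors `Fin 6 → 𝔽_p` (coordinates w.r.t. `1, ζ, …, ζ⁵`). [folklore] -/
structure Z7 (p : ℕ) where
  /-- the six coordinates -/
  v : Fin 6 → ZMod p
  deriving DecidableEq

namespace Z7

variable {p : ℕ}

/-- Two elements agree iff their coordinate vectors agree. [folklore] -/
@[ext] theorem ext {x y : Z7 p} (h : x.v = y.v) : x = y := by cases x; cases y; congr

/-- `Z7 p ≃ (Fin 6 → 𝔽_p)` (as types). [folklore] -/
def equivFun : Z7 p ≃ (Fin 6 → ZMod p) := ⟨fun x => x.v, fun v => ⟨v⟩, fun _ => rfl, fun _ => rfl⟩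

/-- Finite. [folklore] -/
instance [NeZero p] : Fintype (Z7 p) := Fintype.ofEquiv _ equivFun.symm

/-- `|Z7 p| = p⁶`. [folklore] -/
theorem card [NeZero p] : Fintype.card (Z7 p) = p ^ 6 := by
  rw [Fintype.ofEquiv_card, Fintype.card_fun, ZMod.card, Fintype.card_fin]

section transport

variable [Fact (1 < p)]

/-- The coordinate isomorphism `Z7 p ≃ A7 p` (through the basis `bQ`). [folklore] -/
noncomputable def eqA : Z7 p ≃ A7 p where
  toFun x := A7.bQ.equivFun.symm x.v
  invFun y := ⟨A7.bQ.equivFun y⟩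
  left_inv x := by cases x; simp only [LinearEquiv.apply_symm_apply]
  right_inv y := by simp

/-- The ring structure of `ℤ[ζ₇]/p` transported to the coordinate type. [folklore] -/
noncomputable instance : CommRing (Z7 p) := eqA.commRing

/-- `eqA` is additive. [folklore] -/
theorem eqA_add (x y : Z7 p) : eqA (x + y) = eqA x + eqA y := eqA.apply_symm_apply _
/-- `eqA` is multiplicative. [folklore] -/
theorem eqA_mul (x y : Z7 p) : eqA (x * y) = eqA x * eqA y := eqA.apply_symm_apply _
/-- `eqA` on differences. [folklore] -/
theorem eqA_sub (x y : Z7 p) : eqA (x - y) = eqA x - eqA y := eqA.apply_symm_apply _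
/-- `eqA 1 = 1`. [folklore] -/
theorem eqA_one : eqA (1 : Z7 p) = 1 := eqA.apply_symm_apply _
/-- `eqA 0 = 0`. [folklore] -/
theorem eqA_zero : eqA (0 : Z7 p) = 0 := eqA.apply_symm_apply _

/-- Coordinates of `eqA.symm y`. [folklore] -/
theorem v_symm (y : A7 p) : (eqA.symm y).v = A7.bQ.equivFun y := rfl

/-- Coordinates through `eqA`: `x.v = bQ.equivFun (eqA x)`. [folklore] -/
theorem v_eq (x : Z7 p) : x.v = A7.bQ.equivFun (eqA x) := by
  rw [← v_symm (eqA x), Equiv.symm_apply_apply]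

/-- **Coordinates are additive.** [folklore] -/
theorem add_v (x y : Z7 p) : (x + y).v = x.v + y.v := by
  rw [v_eq, eqA_add, map_add, ← v_eq, ← v_eq]

/-- Coordinates of a difference. [folklore] -/
theorem sub_v (x y : Z7 p) : (x - y).v = x.v - y.v := by
  rw [v_eq, eqA_sub, map_sub, ← v_eq, ← v_eq]

/-- Coordinates of `0`. [folklore] -/
theorem zero_v : (0 : Z7 p).v = 0 := by
  rw [v_eq, eqA_zero, map_zero]

/-- `ζ`: the element with abstract image `r`. [folklore] -/
noncomputable def zeta : Z7 p := eqA.symm A7.r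

/-- `eqA zeta = r`. [folklore] -/
theorem eqA_zeta : eqA (zeta : Z7 p) = A7.r := eqA.apply_symm_apply _

/-- `eqA` on powers. [folklore] -/
theorem eqA_pow (x : Z7 p) (n : ℕ) : eqA (x ^ n) = eqA x ^ n := by
  induction n with
  | zero => rw [pow_zero, pow_zero, eqA_one]
  | succ n ih => rw [pow_succ, pow_succ, eqA_mul, ih]

/-- **`ζ⁷ = 1`.** [folklore] -/
theorem zeta_pow_seven : (zeta : Z7 p) ^ 7 = 1 :=
  eqA.injective (by rw [eqA_pow, eqA_zeta, A7.r_pow_seven, eqA_one])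

/-- `Fact` form of `ζ⁷ = 1` (group law of `Z7Cyc`). [folklore] -/
instance fact_zeta_pow_seven : Fact ((zeta : Z7 p) ^ 7 = 1) := ⟨zeta_pow_seven⟩

/-- The companion shift: coordinates of `ζ · x` in terms of those of `x`. [folklore] -/
def shift {R : Type*} [Sub R] [Neg R] (c : Fin 6 → R) : Fin 6 → R :=
  ![-c 5, c 0 - c 5, c 1 - c 5, c 2 - c 5, c 3 - c 5, c 4 - c 5]

/-- The abstract element with coordinates `c`: `Σ c_k r^k`. [folklore] -/
theorem symm_eq_sum (c : Fin 6 → ZMod p) : A7.bQ.equivFun.symm c =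
    algebraMap (ZMod p) (A7 p) (c 0) + algebraMap _ _ (c 1) * A7.r + algebraMap _ _ (c 2) * A7.r ^ 2 +
      algebraMap _ _ (c 3) * A7.r ^ 3 + algebraMap _ _ (c 4) * A7.r ^ 4 + algebraMap _ _ (c 5) * A7.r ^ 5 := by
  rw [Module.Basis.equivFun_symm_apply, Fin.sum_univ_six]
  simp only [A7.bQ_apply, Algebra.smul_def]
  norm_num

/-- **Multiplication by `ζ` is the companion shift on coordinates.** [folklore] -/
theorem zeta_mul_v (x : Z7 p) : (zeta * x).v = shift x.v := by
  have key : A7.r * A7.bQ.equivFun.symm x.v = A7.bQ.equivFun.symm (shift x.v) := by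
    rw [symm_eq_sum, symm_eq_sum]
    simp only [shift, Matrix.cons_val_zero, Matrix.cons_val_one, Matrix.cons_val]
    simp only [map_neg, map_sub]
    linear_combination (algebraMap (ZMod p) (A7 p) (x.v 5)) * A7.sum_pow_r (p := p)
  have h1 : zeta * x = eqA.symm (A7.r * eqA x) := by
    apply eqA.injective
    rw [eqA_mul, eqA_zeta, Equiv.apply_symm_apply]
  rw [h1, v_symm, show eqA x = A7.bQ.equivFun.symm x.v from rfl, key, LinearEquiv.apply_symm_apply]

/-- The companion shift on INTEGER coordinate vectors. [folklore] -/
def lz7 (w : Fin 6 → ℤ) : Fin 6 → ℤ := shift w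

/-- Its iterates `ζ^k · w`. [folklore] -/
def lzpow7 : ℕ → (Fin 6 → ℤ) → (Fin 6 → ℤ)
  | 0, w => w
  | k + 1, w => lz7 (lzpow7 k w)

/-- The element with integer coordinates `w` scaled by `ι` (take `ι = 2⁻¹`). [folklore] -/
def toC (ι : ZMod p) (w : Fin 6 → ℤ) : Z7 p := ⟨fun k => (w k : ZMod p) * ι⟩

/-- `ζ · toC w = toC (lz7 w)`. [folklore] -/
theorem zeta_mul_toC (ι : ZMod p) (w : Fin 6 → ℤ) : zeta * toC ι w = toC ι (lz7 w) := by
  apply ext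
  rw [zeta_mul_v]
  funext k
  fin_cases k <;> simp [shift, lz7, toC] <;> ring

/-- **`ζ^s · toC w = toC (lzpow7 s w)`** (the `RCyc` action). [folklore] -/
theorem act_zeta_toC (ι : ZMod p) (s : ZMod 7) (w : Fin 6 → ℤ) :
    RCyc.act zeta s * toC ι w = toC ι (lzpow7 s.val w) := by
  unfold RCyc.act
  induction s.val with
  | zero => rw [pow_zero, one_mul]; rfl
  | succ k ih => rw [pow_succ', mul_assoc, ih, zeta_mul_toC]; rfl

/-- Sanity check: `ζ⁷ = 1` on integer coordinate vectors. [folklore] -/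
example : lzpow7 7 ![1, 0, 0, 0, 0, 0] = ![1, 0, 0, 0, 0, 0] := by decide

end transport

end Z7

/-- The group `(ℤ[ζ₇]/p) ⋊_ζ ℤ/7` of order `7p⁶` (the Schmidt atom `𝔽_{p⁶} ⋊ C₇` when `ord₇ p = 6`). [folklore] -/
abbrev Z7Cyc (p : ℕ) [Fact (1 < p)] : Type := RCyc (Z7 p) 7 Z7.zeta

/-- `|(ℤ[ζ₇]/p) ⋊ ℤ/7| = 7p⁶`. [folklore] -/
theorem Z7Cyc.card (p : ℕ) [Fact (1 < p)] [NeZero p] : Fintype.card (Z7Cyc p) = p ^ 6 * 7 := by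
  rw [RCyc.card, Z7.card]

end Summit.MatrixMultiplication.OmegaCensus
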